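import Mathlib.Topology.Algebra.Polynomial        -- `Polynomial.continuousOn`, `Polynomial.Splits`, `Polynomial.card_roots'`, ℝ as a normed field
import Mathlib.Topology.Order.IntermediateValue    -- `intermediate_value_Ioo`, `intermediate_value_Ioo'`
import Mathlib.Order.Fin.Basic                     -- `Fin.strictMono_iff_lt_succ`
import HarnessLib

/-!
# R90-TF · S3 · THEOREMS — `R90S3RealRootedOfSignAlternation` ((U3-F) sub-brick F-a2): a real polynomial of degree `d` whose values at `d + 1`
# increasing nodes ALTERNATE in sign has `d` distinct real roots (one in each gap) and splits over `ℝ`; alternation at fixed nodes is OPEN in the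
# coefficients (degree-bounded box); the model `∏ (X − aⱼ)` alternates at interlacing nodes

R90-TF section S3 (successor dealer R90-C12-plan (g2), deal 23:53:12Z «(T3) F-a2 → K2E3-p21»; census K2E3-p17 (g10)
`R90/S3/CENSUS-U3-globalise.K2E3-p17-g10.md` §1 F-a (a2), §3 (T3)); crux H413 (`stmt-HodgeConjecture-24833`, lane `--supports … --as helper`), route
`HCCMUnconditional`.  Serves step F-a («planted totally real field `F′ = ℚ(α)`») of the (U3-F) field-globalisation road behind socket
`stub_R90_S3_auxGlobaliseField` (`Cruxes/H413/Lines/R90_S3_LocalTransportWaveG.lean` :645): the CRT ∕ weak-approximation step F-a1 picks the coefficients of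
`f` in a real box on which `f` is REAL-ROOTED; this file supplies that box.  PURE MATHLIB (real analysis of one variable); THEOREMS ONLY (no `def`, no
`instance`, no notation, no named fact, no `sorry`); never imports `Cruxes/…/Lines`.

THE MATHEMATICS [folklore; e.g. the classical proof that totally real fields with prescribed local behaviour exist — cf. Rogawski1990 §13.8 p. 216 «we can
choose `E∕F` … », where `F` totally real of any degree is taken for granted].  Let `f ∈ ℝ[X]` have `natDegree f = d` and let `x₀ < x₁ < ⋯ < x_d` be nodes with
`f(xᵢ) f(xᵢ₊₁) < 0` (`i < d`).  By the intermediate value theorem each open gap `(xᵢ, xᵢ₊₁)` contains a root; the gaps are disjoint, so `f` has `≥ d`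
distinct real roots; since `#roots ≤ natDegree = d` (Mathlib `card_roots'`), `f` has EXACTLY `d` roots, all real and simple, i.e. `f` splits over `ℝ`
(Mathlib `splits_iff_card_roots`).  Stability: `|f(t) − g(t)| ≤ δ · ∑_{k ≤ n} |t|^k` when `deg f, deg g ≤ n` and all coefficient differences are `≤ δ`, and
strict signs at finitely many nodes survive perturbations smaller than `min |g(xᵢ)|` — so alternation at fixed nodes is an open condition on the
coefficient vector (degree-bounded).  Model: for interlacing data `x₀ < a₀ < x₁ < a₁ < ⋯ < a_{d−1} < x_d` the polynomial `∏ⱼ (X − aⱼ)` alternates at the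
nodes `xᵢ` (exactly the factor `j = i` changes sign between `xᵢ` and `xᵢ₊₁`).
* §1 `exists_isRoot_mem_Ioo_of_mul_eval_neg` (IVT form), `exists_isRoot_mem_Ioo_of_sign_alternation`, **`card_roots_toFinset_eq_of_sign_alternation`**,
  `card_roots_eq_of_sign_alternation`, `nodup_roots_of_sign_alternation`, **`splits_of_sign_alternation`**.
* §2 `abs_eval_sub_eval_le_of_coeff` (coefficient-box bound), `sign_alternation_of_abs_sub_lt`, `eval_node_ne_zero_of_sign_alternation`,
  **`exists_coeff_box_sign_alternation`** (the open box), `splits_of_coeff_close` (box ⇒ real-rooted, packaged for F-a1).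
* §3 `sign_alternation_prod_X_sub_C` (the model alternates — the box is non-empty around any `∏ (X − aⱼ)` with distinct real `aⱼ`).

HONEST LABEL: HC_CM is proved only modulo the 7 printed citations (2 remaining named inputs: hLiu418 = stmt-HodgeConjecture-24832, h413 =
stmt-HodgeConjecture-24833) until rung 0 closes; elementary real analysis for a sub-step of a GENUINE residual ((U3-F)); proves nothing printed; count-neutral.

## References
* [Rogawski1990] J. D. Rogawski, *Automorphic Representations of Unitary Groups in Three Variables*, Ann. of Math. Stud. 123 (1990), §13.8 p. 216 (context:
  the auxiliary global field).
* [CasselsFrohlichANT1967] J. W. S. Cassels, A. Fröhlich (eds.), *Algebraic Number Theory* (1967), Ch. II §6 (weak approximation — the consumer F-a1).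
-/

set_option autoImplicit false
-- the mandated namespace repeats the single-problem summit's segment (`HodgeConjecture.HodgeConjecture`)
set_option linter.dupNamespace false

noncomputable section

namespace Summit.HodgeConjecture.HodgeConjecture.R90.S3

open Polynomial Finset

/-! ## §1 Sign alternation at `d + 1` nodes ⇒ `d` distinct real roots -/

/-- **IVT, sign-change form**: if `a < b` and `f(a) f(b) < 0` then `f` has a root in the open interval `(a, b)`.  (Same statement as the
ValiantsHypothesis tree's `LacunarySymmetroidMatrixDescartes.Census.exists_root_Ioo_of_mul_neg` — another summit's census file, not imported here; 6-line
Mathlib proof repeated.) [folklore] -/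
theorem exists_isRoot_mem_Ioo_of_mul_eval_neg (f : ℝ[X]) {a b : ℝ} (hab : a < b) (h : f.eval a * f.eval b < 0) :
    ∃ r ∈ Set.Ioo a b, f.IsRoot r := by
  rcases mul_neg_iff.1 h with ⟨ha, hb⟩ | ⟨ha, hb⟩
  · -- `f a > 0 > f b`
    obtain ⟨r, hr, hfr⟩ := intermediate_value_Ioo' hab.le (f := fun t => f.eval t) f.continuousOn ⟨hb, ha⟩
    exact ⟨r, hr, hfr⟩
  · -- `f a < 0 < f b`
    obtain ⟨r, hr, hfr⟩ := intermediate_value_Ioo hab.le (f := fun t => f.eval t) f.continuousOn ⟨ha, hb⟩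
    exact ⟨r, hr, hfr⟩

variable {d : ℕ} (f : ℝ[X]) (x : Fin (d + 1) → ℝ) (hx : StrictMono x)
  (halt : ∀ i : Fin d, f.eval (x i.castSucc) * f.eval (x i.succ) < 0)

include hx halt in
/-- **One root in each gap**: under sign alternation at the increasing nodes `x₀ < ⋯ < x_d`, every gap `(xᵢ, xᵢ₊₁)` contains a root of `f`. [folklore] -/
theorem exists_isRoot_mem_Ioo_of_sign_alternation (i : Fin d) : ∃ r ∈ Set.Ioo (x i.castSucc) (x i.succ), f.IsRoot r :=
  exists_isRoot_mem_Ioo_of_mul_eval_neg f (hx (Fin.castSucc_lt_succ (i := i))) (halt i)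

include halt in
/-- Under sign alternation with `d ≥ 1` gaps, `f ≠ 0`. [folklore] -/
theorem ne_zero_of_sign_alternation (hd : 0 < d) : f ≠ 0 := by
  rintro rfl
  have h := halt ⟨0, hd⟩
  rw [eval_zero, zero_mul] at h
  exact lt_irrefl 0 h

include hx halt in
/-- **REAL-ROOTEDNESS BY SIGN ALTERNATION (root count)**: if `natDegree f = d` and the values of `f` at `d + 1` increasing nodes alternate in sign, then
`f` has exactly `d` DISTINCT real roots.  (`≥ d`: one root per gap, the gaps are disjoint; `≤ d`: Mathlib `card_roots'`.) [folklore] -/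
theorem card_roots_toFinset_eq_of_sign_alternation (hf : f.natDegree = d) : f.roots.toFinset.card = d := by
  classical
  have hle : f.roots.toFinset.card ≤ d := (Multiset.toFinset_card_le _).trans ((card_roots' f).trans hf.le)
  refine le_antisymm hle ?_
  rcases Nat.eq_zero_or_pos d with hd | hd
  · rw [hd]; exact Nat.zero_le _
  have hf0 : f ≠ 0 := ne_zero_of_sign_alternation f x halt hd
  choose r hr hroot using exists_isRoot_mem_Ioo_of_sign_alternation f x hx halt
  -- the chosen roots increase strictly with the gap index, hence are pairwise distinct
  have hmono : StrictMono r := by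
    intro i j hij
    calc r i < x i.succ := (hr i).2
      _ ≤ x j.castSucc := hx.monotone (Fin.succ_le_castSucc_iff.2 hij)
      _ < r j := (hr j).1
  have hsub : univ.image r ⊆ f.roots.toFinset := by
    intro t ht
    obtain ⟨i, -, rfl⟩ := mem_image.1 ht
    exact Multiset.mem_toFinset.2 ((mem_roots hf0).2 (hroot i))
  calc d = (univ.image r).card := by rw [card_image_of_injective _ hmono.injective, card_univ, Fintype.card_fin]
    _ ≤ f.roots.toFinset.card := card_le_card hsub

include hx halt in
/-- Root count with multiplicity: `card f.roots = d` under sign alternation (`d ≤ #distinct roots ≤ card roots ≤ natDegree = d`). [folklore] -/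
theorem card_roots_eq_of_sign_alternation (hf : f.natDegree = d) : Multiset.card f.roots = d :=
  le_antisymm ((card_roots' f).trans hf.le)
    ((card_roots_toFinset_eq_of_sign_alternation f x hx halt hf).symm.le.trans (Multiset.toFinset_card_le _))

include hx halt in
/-- All roots are SIMPLE under sign alternation: `f.roots` has no duplicates. [folklore] -/
theorem nodup_roots_of_sign_alternation (hf : f.natDegree = d) : f.roots.Nodup :=
  Multiset.toFinset_card_eq_card_iff_nodup.1
    ((card_roots_toFinset_eq_of_sign_alternation f x hx halt hf).trans (card_roots_eq_of_sign_alternation f x hx halt hf).symm)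

include hx halt in
/-- **REAL-ROOTEDNESS BY SIGN ALTERNATION (splitting)**: under sign alternation at `d + 1 = natDegree f + 1` increasing nodes, `f` SPLITS over `ℝ`
(Mathlib `splits_iff_card_roots`) — for `f ∈ ℚ[X]` irreducible this says `ℚ[X]/(f)` is TOTALLY REAL. [folklore] -/
theorem splits_of_sign_alternation (hf : f.natDegree = d) : f.Splits :=
  splits_iff_card_roots.2 ((card_roots_eq_of_sign_alternation f x hx halt hf).trans hf.symm)

/-! ## §2 Alternation at fixed nodes is an open condition in the coefficients -/

/-- **Coefficient-box bound**: if `deg f, deg g ≤ n` and every coefficient difference is at most `δ` in absolute value, then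
`|f(t) − g(t)| ≤ δ · ∑_{k ≤ n} |t|^k`. [folklore] -/
theorem abs_eval_sub_eval_le_of_coeff (f g : ℝ[X]) {n : ℕ} (hf : f.natDegree ≤ n) (hg : g.natDegree ≤ n) {δ : ℝ}
    (hδ : ∀ k, |f.coeff k - g.coeff k| ≤ δ) (t : ℝ) :
    |f.eval t - g.eval t| ≤ δ * ∑ k ∈ range (n + 1), |t| ^ k := by
  have hdeg : (f - g).natDegree < n + 1 :=
    Nat.lt_succ_of_le ((natDegree_sub_le f g).trans (max_le hf hg))
  rw [← eval_sub, eval_eq_sum_range' hdeg, mul_sum]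
  refine (abs_sum_le_sum_abs _ _).trans (sum_le_sum fun k _ => ?_)
  rw [abs_mul, abs_pow, coeff_sub]
  exact mul_le_mul_of_nonneg_right (hδ k) (pow_nonneg (abs_nonneg t) k)

/-- **Strict signs survive small perturbations**: if `|f(xᵢ) − g(xᵢ)| < |g(xᵢ)|` at every node then `f(xᵢ)` has the (strict) sign of `g(xᵢ)`, so `f`
alternates at the nodes whenever `g` does. [folklore] -/
theorem sign_alternation_of_abs_sub_lt (f g : ℝ[X]) (x : Fin (d + 1) → ℝ)
    (hg : ∀ i : Fin d, g.eval (x i.castSucc) * g.eval (x i.succ) < 0)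
    (hfg : ∀ i : Fin (d + 1), |f.eval (x i) - g.eval (x i)| < |g.eval (x i)|) (i : Fin d) :
    f.eval (x i.castSucc) * f.eval (x i.succ) < 0 := by
  -- same strict sign at every node: `0 < f(xⱼ) g(xⱼ)`
  have hsame : ∀ j : Fin (d + 1), 0 < f.eval (x j) * g.eval (x j) := fun j => by
    have h := hfg j
    rcases lt_trichotomy (g.eval (x j)) 0 with hneg | hzero | hpos
    · rw [abs_of_neg hneg, abs_lt] at h
      exact mul_pos_of_neg_of_neg (by linarith [h.2]) hneg
    · rw [hzero, abs_zero] at h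
      exact absurd h (not_lt.2 (abs_nonneg _))
    · rw [abs_of_pos hpos, abs_lt] at h
      exact mul_pos (by linarith [h.1]) hpos
  have h1 := hsame i.castSucc
  have h2 := hsame i.succ
  have h3 := hg i
  -- `(f₁ f₂)(g₁ g₂) = (f₁ g₁)(f₂ g₂) > 0` with `g₁ g₂ < 0` forces `f₁ f₂ < 0`
  by_contra hcon
  have h4 : 0 ≤ f.eval (x i.castSucc) * f.eval (x i.succ) := not_lt.1 hcon
  nlinarith [mul_nonneg h4 (neg_nonneg.2 h3.le), mul_pos h1 h2]

/-- Under sign alternation with `d ≥ 1`, `g` does not vanish at ANY of the `d + 1` nodes (each node bounds a gap). [folklore] -/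
theorem eval_node_ne_zero_of_sign_alternation (g : ℝ[X]) (x : Fin (d + 1) → ℝ)
    (hg : ∀ i : Fin d, g.eval (x i.castSucc) * g.eval (x i.succ) < 0) (hd : 0 < d) (i : Fin (d + 1)) :
    g.eval (x i) ≠ 0 := by
  intro h0
  by_cases hi : (i : ℕ) < d
  · have h := hg ⟨i, hi⟩
    have hc : (⟨i, hi⟩ : Fin d).castSucc = i := Fin.ext rfl
    rw [hc, h0, zero_mul] at h
    exact lt_irrefl 0 h
  · have hid : (i : ℕ) = d := by have := i.2; omega
    have h := hg ⟨d - 1, by omega⟩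
    have hs : (⟨d - 1, by omega⟩ : Fin d).succ = i := Fin.ext (by simp only [Fin.val_succ]; omega)
    rw [hs, h0, mul_zero] at h
    exact lt_irrefl 0 h

/-- **THE OPEN BOX**: if `g` (of degree `≤ n`) alternates in sign at the nodes `x₀, …, x_d`, there is `ε > 0` such that EVERY `f` of degree `≤ n` whose
coefficients are each within `ε` of those of `g` alternates at the same nodes — alternation at fixed nodes is an open condition on the coefficient vector
(the box a CRT ∕ weak-approximation step instantiates). [folklore] -/
theorem exists_coeff_box_sign_alternation (g : ℝ[X]) {n : ℕ} (hg : g.natDegree ≤ n) (x : Fin (d + 1) → ℝ)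
    (halt_g : ∀ i : Fin d, g.eval (x i.castSucc) * g.eval (x i.succ) < 0) :
    ∃ ε : ℝ, 0 < ε ∧ ∀ f : ℝ[X], f.natDegree ≤ n → (∀ k, |f.coeff k - g.coeff k| < ε) →
      ∀ i : Fin d, f.eval (x i.castSucc) * f.eval (x i.succ) < 0 := by
  rcases Nat.eq_zero_or_pos d with hd | hd
  · subst hd
    exact ⟨1, one_pos, fun _ _ _ i => i.elim0⟩
  -- margin at node `j`: `|g(xⱼ)| / S_j` with `S_j = ∑_{k ≤ n} |xⱼ|^k ≥ 1`
  set S : Fin (d + 1) → ℝ := fun j => ∑ k ∈ range (n + 1), |x j| ^ k with hS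
  have hS1 : ∀ j, 1 ≤ S j := fun j => by
    rw [hS]
    calc (1 : ℝ) = |x j| ^ 0 := (pow_zero _).symm
      _ ≤ ∑ k ∈ range (n + 1), |x j| ^ k :=
        single_le_sum (f := fun k => |x j| ^ k) (fun k _ => pow_nonneg (abs_nonneg _) k) (mem_range.2 (Nat.succ_pos n))
  have hSpos : ∀ j, 0 < S j := fun j => one_pos.trans_le (hS1 j)
  have hm : ∀ j, 0 < |g.eval (x j)| / S j := fun j =>
    div_pos (abs_pos.2 (eval_node_ne_zero_of_sign_alternation g x halt_g hd j)) (hSpos j)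
  obtain ⟨j₀, -, hj₀⟩ := exists_min_image univ (fun j => |g.eval (x j)| / S j) univ_nonempty
  refine ⟨|g.eval (x j₀)| / S j₀, hm j₀, fun f hf hcoeff => sign_alternation_of_abs_sub_lt f g x halt_g fun j => ?_⟩
  -- `|f(xⱼ) − g(xⱼ)| ≤ δ S_j < (|g(xⱼ)| / S_j) S_j = |g(xⱼ)|` with `δ := max_{k ≤ n} |Δcoeff_k| < ε ≤ |g(xⱼ)| / S_j`
  have hε : |g.eval (x j₀)| / S j₀ ≤ |g.eval (x j)| / S j := hj₀ j (mem_univ j)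
  -- `δ := sup over k ≤ n of |Δcoeff_k|` (a finite max, hence `< ε`; coefficients above `n` vanish on both sides)
  set δ : ℝ := (range (n + 1)).sup' ⟨0, mem_range.2 (Nat.succ_pos n)⟩ fun k => |f.coeff k - g.coeff k| with hδdef
  have hδlt : δ < |g.eval (x j₀)| / S j₀ := by
    rw [hδdef, sup'_lt_iff]
    exact fun k _ => hcoeff k
  have hδk : ∀ k, |f.coeff k - g.coeff k| ≤ δ := fun k => by
    by_cases hk : k < n + 1
    · exact le_sup' (f := fun k => |f.coeff k - g.coeff k|) (mem_range.2 hk)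
    · have hk' : n < k := by omega
      rw [coeff_eq_zero_of_natDegree_lt (hf.trans_lt hk'), coeff_eq_zero_of_natDegree_lt (hg.trans_lt hk'), sub_zero, abs_zero]
      exact (abs_nonneg _).trans (le_sup' (f := fun k => |f.coeff k - g.coeff k|) (mem_range.2 (Nat.succ_pos n)))
  calc |f.eval (x j) - g.eval (x j)| ≤ δ * S j := abs_eval_sub_eval_le_of_coeff f g hf hg hδk (x j)
    _ < |g.eval (x j)| / S j * S j := mul_lt_mul_of_pos_right (hδlt.trans_le hε) (hSpos j)
    _ = |g.eval (x j)| := div_mul_cancel₀ _ (hSpos j).ne'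

/-- **Box ⇒ real-rooted** (packaged for F-a1): with `g`, nodes and `ε` as in `exists_coeff_box_sign_alternation` at `n := d`, every `f` with
`natDegree f = d` and coefficients `ε`-close to those of `g` has `d` distinct real roots and splits over `ℝ`. [folklore] -/
theorem splits_of_coeff_close (g : ℝ[X]) (hg : g.natDegree ≤ d) (x : Fin (d + 1) → ℝ) (hx : StrictMono x)
    (halt_g : ∀ i : Fin d, g.eval (x i.castSucc) * g.eval (x i.succ) < 0) :
    ∃ ε : ℝ, 0 < ε ∧ ∀ f : ℝ[X], f.natDegree = d → (∀ k, |f.coeff k - g.coeff k| < ε) →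
      f.Splits ∧ f.roots.toFinset.card = d := by
  obtain ⟨ε, hε, h⟩ := exists_coeff_box_sign_alternation g hg x halt_g
  exact ⟨ε, hε, fun f hf hcoeff =>
    ⟨splits_of_sign_alternation f x hx (h f hf.le hcoeff) hf, card_roots_toFinset_eq_of_sign_alternation f x hx (h f hf.le hcoeff) hf⟩⟩

/-! ## §3 The model: `∏ⱼ (X − aⱼ)` alternates at interlacing nodes -/

/-- **The model alternates**: for interlacing real data `x₀ < a₀ < x₁ < a₁ < ⋯ < a_{d−1} < x_d`, the polynomial `∏ⱼ (X − C aⱼ)` takes values of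
alternating sign at the nodes `xᵢ` — between `xᵢ` and `xᵢ₊₁` exactly the factor `j = i` changes sign, every other factor keeps a strict sign.  (So the
open box of §2 around `∏ (X − aⱼ)` is a non-empty open set of real-rooted polynomials.) [folklore] -/
theorem sign_alternation_prod_X_sub_C (a : Fin d → ℝ) (x : Fin (d + 1) → ℝ) (hxa : ∀ j : Fin d, x j.castSucc < a j ∧ a j < x j.succ)
    (i : Fin d) :
    (∏ j, (X - C (a j))).eval (x i.castSucc) * (∏ j, (X - C (a j))).eval (x i.succ) < 0 := by
  classical
  have hx : StrictMono x := Fin.strictMono_iff_lt_succ.2 fun j => (hxa j).1.trans (hxa j).2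
  simp only [eval_prod, eval_sub, eval_X, eval_C]
  rw [← prod_mul_distrib, ← mul_prod_erase univ (fun j => (x i.castSucc - a j) * (x i.succ - a j)) (mem_univ i)]
  refine mul_neg_of_neg_of_pos (mul_neg_of_neg_of_pos (sub_neg.2 (hxa i).1) (sub_pos.2 (hxa i).2)) (prod_pos fun j hj => ?_)
  rcases lt_or_gt_of_ne (ne_of_mem_erase hj) with hji | hij
  · -- `j < i`: `a j < x (j+1) ≤ x i < x (i+1)`, both factors positive
    have h1 : a j < x i.castSucc := (hxa j).2.trans_le (hx.monotone (Fin.succ_le_castSucc_iff.2 hji))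
    exact mul_pos (sub_pos.2 h1) (sub_pos.2 (h1.trans (hx (Fin.castSucc_lt_succ (i := i)))))
  · -- `i < j`: `x i < x (i+1) ≤ x j < a j`, both factors negative
    have h2 : x i.succ < a j := (hx.monotone (Fin.succ_le_castSucc_iff.2 hij)).trans_lt (hxa j).1
    exact mul_pos_of_neg_of_neg (sub_neg.2 ((hx (Fin.castSucc_lt_succ (i := i))).trans h2)) (sub_neg.2 h2)

end Summit.HodgeConjecture.HodgeConjecture.R90.S3

end
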